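import Literature.Barriers.CriticalPhenomena.LongRangeTrivialityOnZ3UrsellSum

/-!
# `χ_L(β) ≤ C₂ L^{-d} Σ_L(β)` derived from the Messager–Miracle-Solé monotonicity; the barrier
# `LongRangeTrivialityOnZ3` from six printed facts

Sibling of `Literature/Barriers/CriticalPhenomena/LongRangeTrivialityOnZ3.lean` (barrier catalogue
D-0021, sub-problem `Ising3DConformalLimit`). `LongRangeTrivialityOnZ3UrsellSum.lean` derived the
barrier from seven printed named facts (`LongRangeTrivialityOnZ3.of_twoPoint`). One of them,
`panis_boxSusceptibility_le_blockVariance` — "using that `χ_L(β) ≤ C₂L^{-d}Σ_L(β)`", asserted without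
proof on p. 22 of Panis 2023 (arXiv:2309.05797) — is an elementary consequence of another, the
Messager–Miracle-Solé monotonicity `panis_mms_two_point_monotone` (Corollary 3.3 (MMS2): `S(y) ≤ S(x)`
whenever `d|x|_∞ ≤ |y|_∞`), together with translation invariance and `⟨σσ⟩ ≥ 0` (Griffiths), which the
tree proves for these states. This file gives that derivation, for every `d ≥ 1`:

* `card_mul_boxSusceptibility_le_blockVariance`: `Σ_L ≥ |Λ_m| χ_m` for `2m ≤ L`
  (`Σ_L = ∑_{x,y∈Λ_L}⟨σ_xσ_y⟩ ≥ ∑_{x∈Λ_m}∑_{z∈Λ_m}⟨σ_xσ_{x+z}⟩`);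
* `boxSusceptibility_le_doubling`: MMS2 averaged over `Λ_k`, `k = min((m+1)/d, m)`, `m = ⌊L/2⌋`, gives
  `|Λ_k| S(y) ≤ χ_k ≤ χ_m` for `|y|_∞ > m`, and `|Λ_L| ≤ (4d+3)^d|Λ_k|` (`two_mul_add_one_le_doubling`),
  whence `χ_L ≤ (1 + (4d+3)^d) χ_{⌊L/2⌋}`;
* `panis_boxSusceptibility_le_blockVariance_of_mms`: with `|Λ_{⌊L/2⌋}| ≥ L^d`,
  `χ_L ≤ (1+(4d+3)^d) L^{-d} Σ_L`, i.e. the named fact with `C₂ = 1 + (4d+3)^d`;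
* `LongRangeTrivialityOnZ3.of_twoPoint'`: the barrier from `panis_evenMoment_deviation_le`,
  `newman_gaussian_evenMoment_le`, `panis_treeDiagramBound`, `panis_mms_two_point_monotone`,
  `panis_slidingScale_infraredBound`, `panis_infraredBound_algebraic` (six printed facts).

## References

* R. Panis, arXiv:2309.05797 (2023) = Ann. Probab. 54 (2026): Corollary 3.3 (MMS2); proof of Theorem
  5.5, p. 22 ("χ_L(β) ≤ C₂L^{-d}Σ_L(β)") [Panis2023Triviality].
-/

noncomputable section

namespace Literature.Barriers.CriticalPhenomena

open Literature.Probability.LatticeModels Literature.Probability.Percolation Filter Topology Finset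
open scoped symmDiff

namespace LongRangeIsing

variable {d : ℕ}

section Doubling

variable (J : Site d → Site d → ℝ) (β : ℝ)

/-- **`Σ_L(β) ≥ |Λ_m| χ_m(β)` for `2m ≤ L`**: `Σ_L = ∑_{x,y∈Λ_L}⟨σ_xσ_y⟩ ≥ ∑_{x∈Λ_m}∑_{z∈Λ_m}⟨σ_xσ_{x+z}⟩ =
|Λ_m| χ_m` (translation invariance, `⟨σσ⟩ ≥ 0`). [folklore] -/
theorem card_mul_boxSusceptibility_le_blockVariance (hβ : 0 ≤ β) (hJ : ∀ x y, 0 ≤ J x y)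
    (hJt : ∀ a x y, J (x + a) (y + a) = J x y) {m L : ℕ} (hmL : 2 * m ≤ L) :
    (#(box d m) : ℝ) * boxSusceptibility J β m ≤ blockVariance J β L := by
  have hS0 : ∀ x y, 0 ≤ pairCorrelation J β x y := pairCorrelation_nonneg J β hβ hJ
  have hV : blockVariance J β L = ∑ x ∈ box d L, ∑ y ∈ box d L, pairCorrelation J β x y := by
    rw [blockVariance_eq_sum J β hβ hJ L]
    simp_rw [pairCorrelation_eq]
  -- for `x ∈ Λ_m`, the row sum over `Λ_L` dominates `χ_m`
  have hrow : ∀ x ∈ box d m, boxSusceptibility J β m ≤ ∑ y ∈ box d L, pairCorrelation J β x y := by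
    intro x hx
    have hxm := mem_box_iff_supNorm_le.1 hx
    have h1 : boxSusceptibility J β m = ∑ y ∈ (box d m).image (x + ·), pairCorrelation J β x y := by
      rw [Finset.sum_image fun z _ z' _ h => add_left_cancel h, boxSusceptibility]
      refine Finset.sum_congr rfl fun z _ => ?_
      rw [← pairCorrelation_zero_sub J β hβ hJ hJt x (x + z), add_sub_cancel_left]
    rw [h1]
    refine Finset.sum_le_sum_of_subset_of_nonneg (fun y hy => ?_) fun y _ _ => hS0 x y
    obtain ⟨z, hz, rfl⟩ := Finset.mem_image.1 hy
    have hzm := mem_box_iff_supNorm_le.1 hz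
    rw [mem_box_iff_supNorm_le]
    exact (Site.supNorm_add_le x z).trans (by omega)
  have hsub : box d m ⊆ box d L := box_mono d (by omega)
  calc (#(box d m) : ℝ) * boxSusceptibility J β m = ∑ _x ∈ box d m, boxSusceptibility J β m := by
        rw [Finset.sum_const, nsmul_eq_mul]
    _ ≤ ∑ x ∈ box d m, ∑ y ∈ box d L, pairCorrelation J β x y := Finset.sum_le_sum hrow
    _ ≤ ∑ x ∈ box d L, ∑ y ∈ box d L, pairCorrelation J β x y :=
        Finset.sum_le_sum_of_subset_of_nonneg hsub fun x _ _ => Finset.sum_nonneg fun y _ => hS0 x y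
    _ = blockVariance J β L := hV.symm

/-- The integer inequality behind the doubling constant: with `L ≤ 2m+1` and
`k = min((m+1)/d, m)`, `2L + 1 ≤ (4d+3)(2k+1)`. [folklore] -/
theorem two_mul_add_one_le_doubling (hd : 1 ≤ d) {m L : ℕ} (hLm : L ≤ 2 * m + 1) :
    2 * L + 1 ≤ (4 * d + 3) * (2 * min ((m + 1) / d) m + 1) := by
  set q := (m + 1) / d with hq
  have hq1 : m + 1 < q * d + d := by
    have := Nat.lt_div_mul_add (a := m + 1) (Nat.pos_of_ne_zero (by omega) : 0 < d)
    rw [hq]; linarith [this]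
  rcases le_or_gt q m with hqm | hqm
  · rw [min_eq_left hqm]
    nlinarith
  · rw [min_eq_right hqm.le]
    nlinarith

/-- **Messager–Miracle-Solé doubling**: if `S(y) ≤ S(x)` whenever `d|x|_∞ ≤ |y|_∞` (MMS2) then
`χ_L ≤ (1 + (4d+3)^d) χ_{⌊L/2⌋}` (`d ≥ 1`; for `|y| > m := ⌊L/2⌋` average MMS2 over `Λ_k`,
`k = min((m+1)/d, m)`, and compare `|Λ_L| ≤ (4d+3)^d|Λ_k|`). [cite: Panis2023Triviality, Corollary 3.3 (MMS2)] -/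
theorem boxSusceptibility_le_doubling (hd : 1 ≤ d) (hβ : 0 ≤ β) (hJ : ∀ x y, 0 ≤ J x y)
    (hmms : ∀ x y : Site d, (d : ℝ) * ‖x‖ ≤ ‖y‖ → pairCorrelation J β 0 y ≤ pairCorrelation J β 0 x) (L : ℕ) :
    boxSusceptibility J β L ≤ (1 + ((4 * d + 3) ^ d : ℕ)) * boxSusceptibility J β (L / 2) := by
  set m : ℕ := L / 2 with hm
  set k : ℕ := min ((m + 1) / d) m with hk
  have hS0 : ∀ x y, 0 ≤ pairCorrelation J β x y := pairCorrelation_nonneg J β hβ hJ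
  have hkm : k ≤ m := min_le_right _ _
  have hdk : d * k ≤ m + 1 := (Nat.mul_le_mul_left d (min_le_left _ _)).trans (Nat.mul_div_le (m + 1) d)
  have hLm : L ≤ 2 * m + 1 := by omega
  have hmL : m ≤ L := by omega
  -- MMS2 averaged over `Λ_k`: for `|y| ≥ m+1`, `|Λ_k| S(y) ≤ χ_k ≤ χ_m`
  have hfar : ∀ y ∈ box d L \ box d m, (#(box d k) : ℝ) * pairCorrelation J β 0 y ≤ boxSusceptibility J β m := by
    intro y hy
    rw [Finset.mem_sdiff, mem_box_iff_supNorm_le, mem_box_iff_supNorm_le] at hy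
    have h1 : (#(box d k) : ℝ) * pairCorrelation J β 0 y ≤ boxSusceptibility J β k := by
      rw [boxSusceptibility, ← nsmul_eq_mul, ← Finset.sum_const]
      refine Finset.sum_le_sum fun x hx => hmms x y ?_
      rw [Site.norm_eq_supNorm, Site.norm_eq_supNorm]
      have hxk := mem_box_iff_supNorm_le.1 hx
      have : d * Site.supNorm x ≤ Site.supNorm y := by
        calc d * Site.supNorm x ≤ d * k := Nat.mul_le_mul_left d hxk
          _ ≤ m + 1 := hdk
          _ ≤ Site.supNorm y := by omega
      exact_mod_cast this
    exact h1.trans (boxSusceptibility_mono J β hβ hJ hkm)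
  have hcardk : (0 : ℝ) < #(box d k) := by exact_mod_cast (box_nonempty d k).card_pos
  -- `|Λ_L| ≤ (4d+3)^d |Λ_k|`
  have hcards : (#(box d L) : ℝ) ≤ ((4 * d + 3) ^ d : ℕ) * #(box d k) := by
    have h := two_mul_add_one_le_doubling hd hLm
    rw [← hk] at h
    have h2 : (2 * L + 1) ^ d ≤ ((4 * d + 3) * (2 * k + 1)) ^ d := Nat.pow_le_pow_left h d
    rw [card_box, card_box]
    rw [mul_pow] at h2
    exact_mod_cast h2
  -- split `χ_L` at `Λ_m`
  have hsplit : boxSusceptibility J β L =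
      ∑ y ∈ box d L \ box d m, pairCorrelation J β 0 y + boxSusceptibility J β m := by
    rw [boxSusceptibility, boxSusceptibility, Finset.sum_sdiff (box_mono d hmL)]
  have hsum_far : ∑ y ∈ box d L \ box d m, pairCorrelation J β 0 y ≤
      ((4 * d + 3) ^ d : ℕ) * boxSusceptibility J β m := by
    have h1 : ∀ y ∈ box d L \ box d m, pairCorrelation J β 0 y ≤ boxSusceptibility J β m / #(box d k) := by
      intro y hy
      rw [le_div_iff₀ hcardk, mul_comm]
      exact hfar y hy
    have hχ0 : 0 ≤ boxSusceptibility J β m := boxSusceptibility_nonneg J β hβ hJ m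
    calc ∑ y ∈ box d L \ box d m, pairCorrelation J β 0 y
        ≤ ∑ _y ∈ box d L \ box d m, boxSusceptibility J β m / #(box d k) := Finset.sum_le_sum h1
      _ = (#(box d L \ box d m) : ℝ) * (boxSusceptibility J β m / #(box d k)) := by
          rw [Finset.sum_const, nsmul_eq_mul]
      _ ≤ (#(box d L) : ℝ) * (boxSusceptibility J β m / #(box d k)) := by
          refine mul_le_mul_of_nonneg_right ?_ (div_nonneg hχ0 hcardk.le)
          exact_mod_cast Finset.card_le_card Finset.sdiff_subset
      _ ≤ ((4 * d + 3) ^ d : ℕ) * #(box d k) * (boxSusceptibility J β m / #(box d k)) :=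
          mul_le_mul_of_nonneg_right hcards (div_nonneg hχ0 hcardk.le)
      _ = ((4 * d + 3) ^ d : ℕ) * boxSusceptibility J β m := by
          field_simp
  rw [hsplit]
  linarith [hsum_far]

end Doubling

end LongRangeIsing

open LongRangeIsing

/-- **`χ_L(β) ≤ C₂ L^{-d} Σ_L(β)` from the Messager–Miracle-Solé monotonicity** (the inequality used
without proof on p. 22 of the source, here DERIVED from Corollary 3.3 (MMS2), translation invariance
and Griffiths' first inequality): `Σ_L ≥ |Λ_{⌊L/2⌋}|χ_{⌊L/2⌋}`, `χ_L ≤ (1+(4d+3)^d)χ_{⌊L/2⌋}` and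
`|Λ_{⌊L/2⌋}| ≥ L^d`, so `C₂ = 1 + (4d+3)^d`. Hence the named fact
`panis_boxSusceptibility_le_blockVariance` follows from `panis_mms_two_point_monotone`.
[cite: Panis2023Triviality, proof of Theorem 5.5 ("χ_L(β) ≤ C₂L^{-d}Σ_L(β)"), p. 22, with Corollary 3.3 (MMS2)] -/
theorem panis_boxSusceptibility_le_blockVariance_of_mms (hM : panis_mms_two_point_monotone) :
    panis_boxSusceptibility_le_blockVariance := by
  intro d hd C₀ α hC₀ hα
  set J := algebraicCoupling d C₀ α with hJdef
  have hJ0 : ∀ x y, 0 ≤ J x y := algebraicCoupling_nonneg hC₀.le α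
  have hJt : ∀ a x y, J (x + a) (y + a) = J x y := algebraicCoupling_add C₀ α
  refine ⟨1 + ((4 * d + 3) ^ d : ℕ), by positivity, fun β hβ _ L hL => ?_⟩
  have hmms : ∀ x y : Site d, (d : ℝ) * ‖x‖ ≤ ‖y‖ → pairCorrelation J β 0 y ≤ pairCorrelation J β 0 x :=
    fun x y h => hM d hd C₀ α hC₀ hα β hβ x y h
  set m : ℕ := L / 2 with hm
  have hL0 : (0 : ℝ) < L := by exact_mod_cast hL
  have hχm0 : 0 ≤ boxSusceptibility J β m := boxSusceptibility_nonneg J β hβ.le hJ0 m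
  have h1 : boxSusceptibility J β L ≤ (1 + ((4 * d + 3) ^ d : ℕ)) * boxSusceptibility J β m :=
    boxSusceptibility_le_doubling J β hd hβ.le hJ0 hmms L
  have h2 : (#(box d m) : ℝ) * boxSusceptibility J β m ≤ blockVariance J β L :=
    card_mul_boxSusceptibility_le_blockVariance J β hβ.le hJ0 hJt (by omega)
  have h3 : (L : ℝ) ^ d ≤ #(box d m) := by
    rw [card_box]
    exact_mod_cast Nat.pow_le_pow_left (by omega : L ≤ 2 * m + 1) d
  have hLd : (0 : ℝ) < (L : ℝ) ^ d := by positivity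
  have h4 : boxSusceptibility J β m ≤ ((L : ℝ) ^ d)⁻¹ * blockVariance J β L := by
    rw [le_inv_mul_iff₀ hLd]
    calc (L : ℝ) ^ d * boxSusceptibility J β m ≤ (#(box d m) : ℝ) * boxSusceptibility J β m :=
          mul_le_mul_of_nonneg_right h3 hχm0
      _ ≤ blockVariance J β L := h2
  calc boxSusceptibility J β L ≤ (1 + ((4 * d + 3) ^ d : ℕ)) * boxSusceptibility J β m := h1
    _ ≤ (1 + ((4 * d + 3) ^ d : ℕ)) * (((L : ℝ) ^ d)⁻¹ * blockVariance J β L) :=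
        mul_le_mul_of_nonneg_left h4 (by positivity)
    _ = (1 + ((4 * d + 3) ^ d : ℕ)) * ((L : ℝ) ^ d)⁻¹ * blockVariance J β L := by ring

-- names the `@[deprecated]` (refuted) fact `panis_evenMoment_deviation_le` of `…Moments` on purpose: a vacuous record
-- of the printed chain (verdict clean-up 2026-08-16, `…Moments` §Verdict clean-up); REMOVE-WHEN this theorem is retired
set_option linter.deprecated false in
/-- **The barrier from six printed facts**: as `LongRangeTrivialityOnZ3.of_twoPoint`, with
`χ_L ≤ C₂L^{-d}Σ_L` now derived from MMS2 (`panis_boxSusceptibility_le_blockVariance_of_mms`).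
**Vacuous since 2026-08-16:** the hypothesis `panis_evenMoment_deviation_le` is refuted
(`not_panis_evenMoment_deviation_le_of_criticalBeta_pos`, `…Wick`, with
`panis_criticalBeta_pos_holds`; `…Moments`, §Verdict clean-up) — the conclusion is meanwhile a
theorem outright (`panis_mgfDeviation_le_ursellFourBoxSum_holds`, `panis_thm12_holds`,
`LongRangeTrivialityOnZ3_holds`).
[cite: Panis2023Triviality, Theorem 1.2 and proof of Theorem 5.5] -/
theorem LongRangeTrivialityOnZ3.of_twoPoint' (h51 : panis_evenMoment_deviation_le)
    (hN : newman_gaussian_evenMoment_le) (hT : panis_treeDiagramBound) (hM : panis_mms_two_point_monotone)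
    (hSS : panis_slidingScale_infraredBound) (hI : panis_infraredBound_algebraic) : LongRangeTrivialityOnZ3 :=
  LongRangeTrivialityOnZ3.of_twoPoint h51 hN hT hM hSS hI (panis_boxSusceptibility_le_blockVariance_of_mms hM)

end Literature.Barriers.CriticalPhenomena

end
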